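import Summits.ABC.ABC.Theses.IneffectiveSubspace

/-!
# Sketch (crux-ideate r1, ideator 1) — first lemmas for crux `UniformSadicTowerFour` (stmt-ABC-14937)

Card `mixed-radical-exchange-map`: the crux in MIXED-RADICAL normal form (`rad` on `S`, the 4-rounded
radical `R₄` off `S`), the PLACES→LEVEL exchange inequality, the `K`-uniform sandwich with `ABC`, and the
level-one rung of the place dial.  Statements are `def … : Prop` signatures (to be proved by the line),
plus two kernel-checked bookkeeping lemmas (`roundedRadOff_le_sFreePart`, `mixed_le_levelOne_base`).
-/

namespace Summit.ABC.ABC.Cruxes.UniformSadicTowerFour.Sketch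

open scoped BigOperators
open Summit.ABC.ABC.Theses.IneffectiveSubspace
open Literature.NumberTheory.DiophantineGeometry (IsABCTriple rad)

/-- Level-`n` tower inequality with exponent `A` (shape of `TowerLiouvilleExponent`, one level). -/
def TowerIneqAt (n : ℕ) (A : ℝ) : Prop :=
  ∀ ε : ℝ, 0 < ε → ∃ C : ℝ, 0 < C ∧ ∀ x y z : Fin n → ℕ, (∀ i, 0 < x i ∧ 0 < y i ∧ 0 < z i) →
    (∏ i, x i ^ (i.val + 1)) + (∏ i, y i ^ (i.val + 1)) = ∏ i, z i ^ (i.val + 1) →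
    Nat.Coprime (∏ i, x i ^ (i.val + 1)) (∏ i, y i ^ (i.val + 1)) →
    ((∏ i, z i ^ (i.val + 1) : ℕ) : ℝ) < C * ((∏ i, x i * y i * z i : ℕ) : ℝ) ^ (A + ε)

/-- `n`-rounded radical `R_n(m) = ∏_p p^⌈v_p(m)/n⌉` (the least `∏ xᵢ` over level-`n` lifts of `m`). -/
def roundedRad (n m : ℕ) : ℕ :=
  ∏ p ∈ m.primeFactors, p ^ ((m.factorization p + n - 1) / n)

/-- `n`-rounded radical OFF `S`: `R_n^S(m) = ∏_{p ∉ S} p^⌈v_p(m)/n⌉`. -/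
def roundedRadOff (S : Finset ℕ) (n m : ℕ) : ℕ :=
  ∏ p ∈ m.primeFactors \ S, p ^ ((m.factorization p + n - 1) / n)

/-- The `S`-free part `{m}^S = ∏_{p ∉ S} p^{v_p(m)}` (the crux's own expression). -/
def sFreePart (S : Finset ℕ) (m : ℕ) : ℕ :=
  ∏ p ∈ m.primeFactors \ S, p ^ m.factorization p

/-- MIXED-RADICAL NORMAL FORM of the crux at depth-budget `K`: abc with the radical charged `p` on `S`
and `p^⌈v_p/4⌉` off `S`, uniformly over `|S| ≤ K` (optimal level-4 lifts; `R₄(a)R₄(b)R₄(c) = R₄(abc)`). -/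
def MixedRadicalABC (K : ℕ) : Prop :=
  ∀ ε : ℝ, 0 < ε → ∃ C : ℝ, 0 < C ∧ ∀ S : Finset ℕ, S.card ≤ K → (∀ p ∈ S, Nat.Prime p) →
    ∀ a b c : ℕ, IsABCTriple a b c →
      (c : ℝ) < C * ((((∏ p ∈ S, p) * roundedRadOff S 4 (a * b * c) : ℕ) : ℝ)) ^ (1 + ε)

/-- L0 (normal form, bookkeeping both ways: optimal lifts one way, `v_p(∏xᵢ) ≥ ⌈v_p(a)/4⌉` the other). -/
def NormalForm : Prop := UniformSadicTowerFour ↔ ∀ K : ℕ, MixedRadicalABC K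

/-- L1 (EXCHANGE INEQUALITY, places → level; elementary, for EVERY finite set of primes `S`, no size
bound): `R_N(m) ≤ (∏_{p∈S} p) · m^{1/N} · R₄^S(m)` for `N ≥ 4` (`⌈v/N⌉ ≤ 1 + v/N` on `S`,
`⌈v/N⌉ ≤ ⌈v/4⌉` off `S`). -/
def ExchangeIneq : Prop :=
  ∀ N : ℕ, 4 ≤ N → ∀ S : Finset ℕ, (∀ p ∈ S, Nat.Prime p) → ∀ m : ℕ, 0 < m →
    (roundedRad N m : ℝ) ≤ (∏ p ∈ S, p : ℕ) * (m : ℝ) ^ ((1 : ℝ) / N) * (roundedRadOff S 4 m : ℕ)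

/-- L2 (PLACES→LEVEL TRANSFER): Vojta's inequality with exponent 1 at the single level `N` (at
`S = {∞}`, no places at all) implies the crux inequality for EVERY finite set of primes `S` — no
cardinality bound, constant independent of `S` — at exponent `(1+ε)N/(N − 3(1+ε))`.  So the
`S`-uniformity asked by the crux is FREE given the level tower; `∀ N, TowerIneqAt N 1` (⟺ ABC,
`Cruxes/TowerThesis/Disproof.lean`) gives the crux with `K`-free constants. -/
def PlacesToLevel : Prop :=
  ∀ N : ℕ, 4 ≤ N → TowerIneqAt N 1 → ∀ ε : ℝ, 0 < ε → 3 * (1 + ε) < N → ∃ C : ℝ, 0 < C ∧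
    ∀ S : Finset ℕ, (∀ p ∈ S, Nat.Prime p) → ∀ a b c : ℕ, IsABCTriple a b c →
      (c : ℝ) < C * ((((∏ p ∈ S, p) * roundedRadOff S 4 (a * b * c) : ℕ) : ℝ)) ^
        ((1 + ε) * N / (N - 3 * (1 + ε)))

/-- L3 (the `K`-UNIFORM SANDWICH): the crux with a constant independent of `K` is `ABC` on the nose
(`→`: take `S :=` the primes at depth `≥ 5`, then the mixed radical is `rad(abc)`; `←`: `rad ≤` mixed
radical).  Hence `DepthUniformity` ≡ "`sup_K C(K,ε) < ∞`" for the crux's own constants. -/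
def UniformInK_iff_ABC : Prop :=
  (∀ ε : ℝ, 0 < ε → ∃ C : ℝ, 0 < C ∧ ∀ S : Finset ℕ, (∀ p ∈ S, Nat.Prime p) →
    ∀ a b c : ℕ, IsABCTriple a b c →
      (c : ℝ) < C * ((((∏ p ∈ S, p) * roundedRadOff S 4 (a * b * c) : ℕ) : ℝ)) ^ (1 + ε)) ↔ ABC

/-- LEVEL-ONE RUNG of the place dial ("uniform Mahler–Ridout with linear `S`-loss"): no rounding at
all off `S`.  `K = 0, 1` are trivial (`ab ≥ c − 1`); `K = 2` already contains Hall's inequality for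
prime arguments (L6). -/
def LevelOneRung (K : ℕ) : Prop :=
  ∀ ε : ℝ, 0 < ε → ∃ C : ℝ, 0 < C ∧ ∀ S : Finset ℕ, S.card ≤ K → (∀ p ∈ S, Nat.Prime p) →
    ∀ a b c : ℕ, IsABCTriple a b c →
      (c : ℝ) < C * ((((∏ p ∈ S, p) * sFreePart S (a * b * c) : ℕ) : ℝ)) ^ (1 + ε)

/-- L4: the crux at budget `K` implies the level-one rung at budget `K` (`R₄^S ≤ {·}^S`). -/
def CruxGivesLevelOne : Prop := ∀ K : ℕ, MixedRadicalABC K → LevelOneRung K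

/-- abc with a constant depending on `ω(abc)` (Baker/Granville-type cell; `K ≤ 2` is elementary:
`2^l ± 1 = q^m` forces `m = 1` or `8 + 1 = 9`). -/
def OmegaCountedABC (K : ℕ) : Prop :=
  ∀ ε : ℝ, 0 < ε → ∃ C : ℝ, 0 < C ∧ ∀ a b c : ℕ, IsABCTriple a b c →
    (a * b * c).primeFactors.card ≤ K → (c : ℝ) < C * ((rad a b c : ℕ) : ℝ) ^ (1 + ε)

/-- L5: the level-one rung at `K` contains abc on the cell `ω(abc) ≤ K` (take `S := supp(abc)`). -/
def LevelOneGivesOmega : Prop := ∀ K : ℕ, LevelOneRung K → OmegaCountedABC K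

/-- L6 (where the place dial is already hard): the level-one rung at `K = 2` gives Hall's inequality
for PRIME arguments, `|q³ − p²| ≥ q^{1/2−ε}/C(ε)` (triple `(p², q³ − p², q³)`, `S = {p, q}`). -/
def LevelOneTwoGivesPrimeHall : Prop :=
  LevelOneRung 2 → ∀ ε : ℝ, 0 < ε → ∃ C : ℝ, 0 < C ∧ ∀ p q : ℕ, p.Prime → q.Prime →
    (q : ℤ) ^ 3 ≠ (p : ℤ) ^ 2 → (q : ℝ) ^ ((1 : ℝ) / 2 - ε) ≤ C * |((q : ℝ) ^ 3 - (p : ℝ) ^ 2)|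

/-- L7 (elementary strata, provable now): `LevelOneRung 1` and `OmegaCountedABC 2`. -/
def ElementaryStrata : Prop := LevelOneRung 1 ∧ OmegaCountedABC 2


/-- Faltings for the Fermat-quartic twists `uX⁴ + vY⁴ = wZ⁴` (genus 3): finitely many coprime positive
solutions per twist.  UNPROVED in the tree (Faltings 1983); used only as a hypothesis. -/
def FermatQuarticTwistsFinite : Prop :=
  ∀ u v w : ℕ, 0 < u → 0 < v → 0 < w →
    Set.Finite {t : ℕ × ℕ × ℕ | 0 < t.1 ∧ 0 < t.2.1 ∧ 0 < t.2.2 ∧ Nat.Coprime t.1 t.2.1 ∧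
      u * t.1 ^ 4 + v * t.2.1 ^ 4 = w * t.2.2 ^ 4}

/-- L8 (FIXED-SUPPORT STRATUM, for every `S` at once): given Faltings for the quartic twists, for each
finite set of primes `P` only finitely many positive coprime level-4 points have all nine LOW coordinates
(`xᵢ, yᵢ, zᵢ`, `i < 3`) supported in `P` (reduce `u = x₀x₁²x₂³` etc. modulo fourth powers of `P`-units:
finitely many twists, finitely many projective points each, coprimality pins the scaling).  On a finite
set the crux inequality holds with `C = C(P)` for every `S`. -/
def FixedSupportStratum : Prop :=
  FermatQuarticTwistsFinite → ∀ P : Finset ℕ,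
    Set.Finite {xyz : (Fin 4 → ℕ) × (Fin 4 → ℕ) × (Fin 4 → ℕ) |
      (∀ i, 0 < xyz.1 i ∧ 0 < xyz.2.1 i ∧ 0 < xyz.2.2 i) ∧
      (∏ i, xyz.1 i ^ (i.val + 1)) + (∏ i, xyz.2.1 i ^ (i.val + 1)) = ∏ i, xyz.2.2 i ^ (i.val + 1) ∧
      Nat.Coprime (∏ i, xyz.1 i ^ (i.val + 1)) (∏ i, xyz.2.1 i ^ (i.val + 1)) ∧
      ∀ i : Fin 4, i.val < 3 → (xyz.1 i * xyz.2.1 i * xyz.2.2 i).primeFactors ⊆ P}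

/-- L9 (β/RV no-go carries over to every `S`): the crux at `K = 0` IS `TowerIneqAt 4 1` (`S = ∅`), so any
engine for the crux proves Vojta's inequality with the FULL canonical coefficient at `S = {∞}` on level 4;
recorded as the implication the line must not contradict. -/
def CruxZeroIsLevelFour : Prop := MixedRadicalABC 0 ↔ TowerIneqAt 4 1

/-! ### Two kernel-checked bookkeeping lemmas -/

/-- `R₄^S(m) ≤ {m}^S`: rounding down exponents off `S` only lowers the product. -/
theorem roundedRadOff_le_sFreePart (S : Finset ℕ) (m : ℕ) :
    roundedRadOff S 4 m ≤ sFreePart S m := by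
  unfold roundedRadOff sFreePart
  apply Finset.prod_le_prod'
  intro p hp
  have hp' : p ∈ m.primeFactors := (Finset.mem_sdiff.mp hp).1
  have hppos : 0 < p := (Nat.prime_of_mem_primeFactors hp').pos
  apply Nat.pow_le_pow_right hppos
  omega

/-- The real-cast base comparison used to pass from the crux to the level-one rung. -/
theorem mixed_le_levelOne_base (S : Finset ℕ) (m : ℕ) :
    ((((∏ p ∈ S, p) * roundedRadOff S 4 m : ℕ) : ℝ)) ≤ (((∏ p ∈ S, p) * sFreePart S m : ℕ) : ℝ) := by
  exact_mod_cast Nat.mul_le_mul_left _ (roundedRadOff_le_sFreePart S m)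

end Summit.ABC.ABC.Cruxes.UniformSadicTowerFour.Sketch
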